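import Literature.Barriers.SmoothPoincare4.ExoticOpenFourSpacePolarProofs
import Literature.Topology.FourManifolds.FreedmanApproximation
import Literature.AlgebraicTopology.SingularHomology.CellCentreLocalisation
import Mathlib.Topology.Compactification.OnePoint.Sphere
import HarnessLib

/-!
# `deMichelisFreedman1992_continuum`: the last assertion of Thm. 4.1 — a topological radial
# function, restricted to `[0, r]`, extends to a topological polar coordinate on all of `ℝ⁴`
# (by the generalized Schoenflies theorem)

Proof file in the cone of the named fact
`Literature.Barriers.SmoothPoincare4.deMichelisFreedman1992_continuum` (DeMichelis–Freedman 1992,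
Thm. 4.1 with Cor. 4.1: continuum many pairwise non-diffeomorphic open subsets of standard `ℝ⁴`,
each homeomorphic to `ℝ⁴`; `ExoticOpenFourSpace.lean`), sibling of
`ExoticOpenFourSpacePolarProofs` (the polar family `polarBall R e t` of Thm. 4.1 and the reduction of
the fact to the gauge-theoretic no-go). Thm. 4.1 (p. 246, verbatim):

> "Any open subset of a Euclidean space acquires a natural smooth structure by restriction. By a
> topological radial function we mean a homeomorphism followed by the usual radius function
> `ℝ⁴_std → [0, ∞)`. **Theorem 4.1.** There is a subset `R⁴₁` of Euclidean 4-space `ℝ⁴_std`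
> which is homeomorphic but not diffeomorphic to `ℝ⁴_std`. Moreover, `R⁴₁` has a topological
> system of polar coordinates with radial function `ρ` so that the open balls of radius `r` are
> "ribbon 4-spaces" `R⁴_t` in the sense of §3 whenever `t = 1 − 1/r` belongs to the standard
> Cantor set `CS ⊂ [0, 1]`. […] **Also, `ρ` restricted to `[0, r]` for any `r` extends to a
> topological polar coordinate on all of `ℝ⁴_std`.**"

and its proof ends (p. 248): "The final assertion of Theorem 4.1 follows from the Schoenflies
theorem." THIS FILE PROVES that final assertion, for every open `R ⊆ ℝⁿ` (`n ≥ 2`) with a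
homeomorphism `e : R ≅ ℝⁿ` (the radial function being `ρ = ‖e ·‖`) and every `r > 0`:
**there is a homeomorphism `H : ℝⁿ ≅ ℝⁿ` with `H = e` on the closed `ρ`-ball `{ρ ≤ r}`**
(`exists_homeomorph_eq_of_norm_le`; `n = 4`: `exists_homeomorph_eq_of_norm_le_four`), so that
`‖H ·‖` is a topological polar coordinate on all of `ℝⁿ` whose restriction to `[0, r]` is `ρ`
(`exists_homeomorph_norm_eq_of_norm_le`: `‖H x‖ = ρ(x)` for `ρ(x) ≤ r` and `{‖H‖ ≤ r} = {ρ ≤ r}`),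
and, in the parametrisation `t = 1 − 1/r` of the polar family, `H` carries the tree's
`polarBall R e t` onto the round ball of radius `(1 − t)⁻¹` (`exists_homeomorph_eq_of_polar`).

The Schoenflies theorem meant is M. Brown's generalized (topological, bicollared) Schoenflies
theorem, PROVED in the tree (`Literature/Topology/FourManifolds/Schoenflies{Cellularity,Brown,Flat,
Separation}.lean`, Daverman Thm. II.6.6) and used here through its "complement of a tame round
ball is a cell" form `IsTopSphere.nonempty_homeomorph_compl_image_ball` with the boundary
identification `IsTopSphere.norm_eq_one_iff_compl_image_ball` (`FreedmanApproximation.lean` §1).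
The one-line printed proof, spelled out (Steps 1–6 below): in the one-point compactification
`S = ℝⁿ ∪ {∞} ≅ Sⁿ` (Mathlib `onePointEquivSphereOfFinrankEq`; `isTopSphere_sphere`) the
`ρ`-sphere `e⁻¹(∂B(0, r))` is bicollared (it has the round collar of `g = e⁻¹` read in `S`), so
the closure `S ∖ e⁻¹(B(0, r))` of its outer side is an `n`-cell whose boundary is the `ρ`-sphere,
and so is the outside `S ∖ B(0, r)` of the round sphere; normalise both cell maps to send `∞` to
the centre (Step 1, the tree's `exists_homeomorph_closedBall_apply_zero_eq`: a homeomorphism of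
`B̄` fixing `∂B̄` and moving the centre), identify the two boundary spheres with `∂B̄ⁿ` (Step 2) and
cone the resulting boundary correspondence over `B̄ⁿ` (Alexander trick, the tree's `coneHomeomorph`),
obtaining a homeomorphism of the outer cells fixing `∞` and equal to `e` on the `ρ`-sphere
(Step 3); paste it with `e` on the closed `ρ`-ball — a continuous bijection of the compact
Hausdorff `S`, hence a homeomorphism (Step 4); remove `∞` (Step 5).

No definition and no named fact is introduced (D-0026); everything is a theorem.

## References

* S. DeMichelis, M. H. Freedman, *Uncountably many exotic `R⁴`'s in standard 4-space*,
  J. Differential Geom. 35 (1992) 219–254: Thm. 4.1 (p. 246) and the last line of its proof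
  (p. 248) [DeMichelisFreedman1992].
* M. Brown, *A proof of the generalized Schoenflies theorem*, Bull. Amer. Math. Soc. 66 (1960)
  74–76; R. J. Daverman, *Decompositions of manifolds* (1986), §II.6 Thm. 6 — as vendored and
  proved in `Literature/Topology/FourManifolds/SchoenfliesSeparation.lean` [Daverman1986].

[DeMichelisFreedman1992]
-/

noncomputable section

open Set Function Metric Filter Topology
open Literature.Topology.FourManifolds
open Literature.AlgebraicTopology.SingularHomology

namespace Literature.Barriers.SmoothPoincare4

/-! ### Step 1. Normalising a cell map: a given interior point goes to the centre -/

/-- **Normalisation of a cell homeomorphism.** If `Ψ : C ≅ B̄` (closed unit ball of a proper real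
normed space) sends `z₀` into the open ball, then some `Ψ' : C ≅ B̄` sends `z₀` to the centre and
has the same boundary set `{‖Ψ'‖ = 1} = {‖Ψ‖ = 1}` — compose with a homeomorphism of `B̄` fixing
`∂B̄` pointwise and moving the centre (`exists_homeomorph_closedBall_apply_zero_eq`). [folklore] -/
theorem exists_homeomorph_apply_eq_zero_of_norm_lt {F : Type*} [NormedAddCommGroup F]
    [NormedSpace ℝ F] [ProperSpace F] {C : Type*} [TopologicalSpace C]
    (Ψ : C ≃ₜ closedBall (0 : F) 1) (z₀ : C) (hz₀ : ‖(Ψ z₀ : F)‖ < 1) :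
    ∃ Ψ' : C ≃ₜ closedBall (0 : F) 1, (Ψ' z₀ : F) = 0 ∧
      ∀ z, ‖(Ψ' z : F)‖ = 1 ↔ ‖(Ψ z : F)‖ = 1 := by
  obtain ⟨T, hT0, hTfix⟩ := exists_homeomorph_closedBall_apply_zero_eq (E := F) one_pos
    (c := (Ψ z₀ : F)) (mem_ball_zero_iff.2 hz₀)
  have h0 : T ⟨0, mem_closedBall_self zero_le_one⟩ = Ψ z₀ := Subtype.ext hT0
  refine ⟨Ψ.trans T.symm, ?_, fun z ↦ ?_⟩
  · rw [Homeomorph.trans_apply, ← h0, Homeomorph.symm_apply_apply]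
  · rw [Homeomorph.trans_apply]
    constructor
    · intro h1
      have hfix := hTfix (T.symm (Ψ z)) (mem_sphere_zero_iff_norm.2 h1)
      rw [Homeomorph.apply_symm_apply] at hfix
      rw [hfix]
      exact h1
    · intro h1
      have hfix : T (Ψ z) = Ψ z := hTfix (Ψ z) (mem_sphere_zero_iff_norm.2 h1)
      have h2 : T.symm (Ψ z) = Ψ z := by rw [Homeomorph.symm_apply_eq, hfix]
      rw [h2]
      exact h1

/-! ### Step 2. The boundary sphere of the cell: `∂B(0, r) ≅ ∂B̄` through `Ψ ∘ g` -/

variable {n : ℕ}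

/-- For an injective `g`, a point `g w` with `‖w‖ = r` is not in `g(B(0, r))`. [folklore] -/
theorem apply_mem_compl_image_ball {X S : Type*} [SeminormedAddCommGroup X] {g : X → S}
    (hgi : Injective g) {r : ℝ} {w : X} (hw : r ≤ ‖w‖) :
    g w ∈ (g '' ball (0 : X) r)ᶜ := by
  rintro ⟨v, hv, hvw⟩
  rw [hgi hvw, mem_ball_zero_iff] at hv
  exact (not_lt.2 hw) hv

/-- **The boundary correspondence as a homeomorphism of spheres.** For a continuous injective
`g : ℝⁿ → S` (`S` Hausdorff) and a homeomorphism `Ψ : S ∖ g(B(0, r)) ≅ B̄ⁿ` whose norm-one set is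
exactly `g(∂B(0, r))`, the map `w ↦ Ψ(g w)` is a homeomorphism `∂B(0, r) ≅ ∂B̄ⁿ` (a continuous
bijection from a compact space to a Hausdorff one). [folklore] -/
theorem exists_sphere_homeomorph_boundary {S : Type*} [TopologicalSpace S] [T2Space S]
    {g : EuclideanSpace ℝ (Fin n) → S} (hgc : Continuous g) (hgi : Injective g) {r : ℝ}
    (Ψ : ↥(g '' ball (0 : EuclideanSpace ℝ (Fin n)) r)ᶜ ≃ₜ closedBall (0 : EuclideanSpace ℝ (Fin n)) 1)
    (hb : ∀ z, ‖(Ψ z : EuclideanSpace ℝ (Fin n))‖ = 1 ↔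
      (z : S) ∈ g '' sphere (0 : EuclideanSpace ℝ (Fin n)) r) :
    ∃ β : sphere (0 : EuclideanSpace ℝ (Fin n)) r ≃ₜ sphere (0 : EuclideanSpace ℝ (Fin n)) 1,
      ∀ (w : EuclideanSpace ℝ (Fin n)) (hw : w ∈ sphere (0 : EuclideanSpace ℝ (Fin n)) r)
        (hm : g w ∈ (g '' ball (0 : EuclideanSpace ℝ (Fin n)) r)ᶜ),
        (β ⟨w, hw⟩ : EuclideanSpace ℝ (Fin n)) = Ψ ⟨g w, hm⟩ := by
  have hmem : ∀ w : sphere (0 : EuclideanSpace ℝ (Fin n)) r,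
      g w ∈ (g '' ball (0 : EuclideanSpace ℝ (Fin n)) r)ᶜ := fun w ↦
    apply_mem_compl_image_ball hgi (mem_sphere_zero_iff_norm.1 w.2).ge
  have hone : ∀ w : sphere (0 : EuclideanSpace ℝ (Fin n)) r,
      ‖(Ψ ⟨g w, hmem w⟩ : EuclideanSpace ℝ (Fin n))‖ = 1 := fun w ↦
    (hb _).2 ⟨w, w.2, rfl⟩
  set βf : sphere (0 : EuclideanSpace ℝ (Fin n)) r → sphere (0 : EuclideanSpace ℝ (Fin n)) 1 :=
    fun w ↦ ⟨Ψ ⟨g w, hmem w⟩, mem_sphere_zero_iff_norm.2 (hone w)⟩ with hβf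
  have hcont : Continuous βf := by
    refine Continuous.subtype_mk (continuous_subtype_val.comp (Ψ.continuous.comp ?_)) _
    exact (hgc.comp continuous_subtype_val).subtype_mk _
  have hinj : Injective βf := by
    intro w₁ w₂ h
    simp only [hβf, Subtype.mk.injEq] at h
    have h2 := Ψ.injective (Subtype.ext h)
    exact Subtype.ext (hgi (congrArg Subtype.val h2))
  have hsurj : Surjective βf := by
    intro u
    set z := Ψ.symm ⟨u, sphere_subset_closedBall u.2⟩ with hz
    have hz1 : ‖(Ψ z : EuclideanSpace ℝ (Fin n))‖ = 1 := by
      rw [hz, Homeomorph.apply_symm_apply]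
      exact mem_sphere_zero_iff_norm.1 u.2
    obtain ⟨w, hw, hgw⟩ := (hb z).1 hz1
    refine ⟨⟨w, hw⟩, Subtype.ext ?_⟩
    have h3 : (⟨g w, hmem ⟨w, hw⟩⟩ : ↥(g '' ball (0 : EuclideanSpace ℝ (Fin n)) r)ᶜ) = z :=
      Subtype.ext hgw
    show (Ψ ⟨g w, hmem ⟨w, hw⟩⟩ : EuclideanSpace ℝ (Fin n)) = u
    rw [h3, hz, Homeomorph.apply_symm_apply]
  refine ⟨Continuous.homeoOfEquivCompactToT2 (f := Equiv.ofBijective βf ⟨hinj, hsurj⟩) hcont,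
    fun w hw hm ↦ rfl⟩

/-! ### Step 3. The outer cells: `S ∖ g(B(0, r)) ≅ S ∖ g₀(B(0, r))` fixing `N`, prescribed on the boundary -/

/-- **The outer homeomorphism.** In a compact metric topological `n`-sphere `S` (`n ≥ 2`) let
`g, g₀ : ℝⁿ → S` be open embeddings missing the point `N`. By the generalized Schoenflies theorem
(the tree's `IsTopSphere.nonempty_homeomorph_compl_image_ball`, Brown 1960 / Daverman II.6.6, with
the boundary identified by `IsTopSphere.norm_eq_one_iff_compl_image_ball`) both `S ∖ g(B(0, r))` and
`S ∖ g₀(B(0, r))` are `n`-cells with boundary spheres `g(∂B(0, r))`, `g₀(∂B(0, r))`; normalising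
the cell maps so that `N ↦ 0` (Step 1) and correcting by the cone (Alexander trick,
`coneHomeomorph`) over the boundary correspondence `Ψ(g w) ↦ Ψ₀(g₀ w)` (Step 2) gives a
homeomorphism `Ω` of the outer cells with `Ω N = N` and `Ω (g w) = g₀ w` for `‖w‖ = r`.
[cite: DeMichelisFreedman1992, §4 proof of Thm. 4.1 (final assertion), p. 248] -/
theorem exists_homeomorph_compl_image_ball {S : Type*} [MetricSpace S] [CompactSpace S]
    (hS : IsTopSphere n S) (hn : 2 ≤ n) {g g₀ : EuclideanSpace ℝ (Fin n) → S}
    (hg : IsOpenEmbedding g) (hg₀ : IsOpenEmbedding g₀) {N : S} (hN : N ∉ range g)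
    (hN₀ : N ∉ range g₀) {r : ℝ} (hr : 0 < r) :
    ∃ Ω : ↥(g '' ball (0 : EuclideanSpace ℝ (Fin n)) r)ᶜ ≃ₜ ↥(g₀ '' ball (0 : EuclideanSpace ℝ (Fin n)) r)ᶜ,
      (∀ hm hm₀, Ω ⟨N, hm⟩ = ⟨N, hm₀⟩) ∧
      ∀ w ∈ sphere (0 : EuclideanSpace ℝ (Fin n)) r, ∀ hm hm₀, Ω ⟨g w, hm⟩ = ⟨g₀ w, hm₀⟩ := by
  -- the two cells (generalized Schoenflies theorem) and their boundary spheres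
  have cell : ∀ {k : EuclideanSpace ℝ (Fin n) → S}, IsOpenEmbedding k → N ∉ range k →
      ∃ Ψ : ↥(k '' ball (0 : EuclideanSpace ℝ (Fin n)) r)ᶜ ≃ₜ closedBall (0 : EuclideanSpace ℝ (Fin n)) 1,
        (∀ hm, (Ψ ⟨N, hm⟩ : EuclideanSpace ℝ (Fin n)) = 0) ∧
        ∀ z, ‖(Ψ z : EuclideanSpace ℝ (Fin n))‖ = 1 ↔
          (z : S) ∈ k '' sphere (0 : EuclideanSpace ℝ (Fin n)) r := by
    intro k hk hNk
    have hkc : ContinuousOn k (closedBall (0 : EuclideanSpace ℝ (Fin n)) (2 * r)) :=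
      hk.continuous.continuousOn
    have hki : InjOn k (closedBall (0 : EuclideanSpace ℝ (Fin n)) (2 * r)) := hk.injective.injOn
    have hko : ∀ r', 0 < r' → r' ≤ 2 * r →
        IsOpen (k '' ball (0 : EuclideanSpace ℝ (Fin n)) r') := fun r' _ _ ↦
      hk.isOpenMap _ isOpen_ball
    obtain ⟨Ψ⟩ := hS.nonempty_homeomorph_compl_image_ball hn hr hkc hki hko
    have hb : ∀ z, ‖(Ψ z : EuclideanSpace ℝ (Fin n))‖ = 1 ↔
        (z : S) ∈ k '' sphere (0 : EuclideanSpace ℝ (Fin n)) r := fun z ↦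
      hS.norm_eq_one_iff_compl_image_ball hr hkc Ψ z
    have hNm : N ∈ (k '' ball (0 : EuclideanSpace ℝ (Fin n)) r)ᶜ := fun ⟨v, _, hv⟩ ↦ hNk ⟨v, hv⟩
    have hN1 : ‖(Ψ ⟨N, hNm⟩ : EuclideanSpace ℝ (Fin n))‖ < 1 := by
      refine lt_of_le_of_ne (mem_closedBall_zero_iff.1 (Ψ ⟨N, hNm⟩).2) fun h1 ↦ hNk ?_
      obtain ⟨v, -, hv⟩ := (hb _).1 h1
      exact ⟨v, hv⟩
    obtain ⟨Ψ', h0, hb'⟩ := exists_homeomorph_apply_eq_zero_of_norm_lt Ψ ⟨N, hNm⟩ hN1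
    exact ⟨Ψ', fun hm ↦ h0, fun z ↦ (hb' z).trans (hb z)⟩
  obtain ⟨Ψ, hΨN, hb⟩ := cell hg hN
  obtain ⟨Ψ₀, hΨ₀N, hb₀⟩ := cell hg₀ hN₀
  -- the boundary correspondence and its cone extension
  obtain ⟨β, hβ⟩ := exists_sphere_homeomorph_boundary hg.continuous hg.injective Ψ hb
  obtain ⟨β₀, hβ₀⟩ := exists_sphere_homeomorph_boundary hg₀.continuous hg₀.injective Ψ₀ hb₀
  set φ : sphere (0 : EuclideanSpace ℝ (Fin n)) 1 ≃ₜ sphere (0 : EuclideanSpace ℝ (Fin n)) 1 :=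
    β.symm.trans β₀ with hφ
  haveI : Nonempty (sphere (0 : EuclideanSpace ℝ (Fin n)) 1) :=
    ⟨⟨EuclideanSpace.single (⟨0, by omega⟩ : Fin n) (1 : ℝ), by simp⟩⟩
  set Φ := coneHomeomorph φ with hΦ
  have hNm : N ∈ (g '' ball (0 : EuclideanSpace ℝ (Fin n)) r)ᶜ := fun ⟨v, _, hv⟩ ↦ hN ⟨v, hv⟩
  have hNm₀ : N ∈ (g₀ '' ball (0 : EuclideanSpace ℝ (Fin n)) r)ᶜ := fun ⟨v, _, hv⟩ ↦ hN₀ ⟨v, hv⟩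
  refine ⟨Ψ.trans (Φ.trans Ψ₀.symm), fun hm hm₀ ↦ ?_, fun w hw hm hm₀ ↦ ?_⟩
  · -- `N ↦ 0 ↦ 0 ↦ N`
    rw [Homeomorph.trans_apply, Homeomorph.trans_apply, Homeomorph.symm_apply_eq]
    apply Subtype.ext
    have h1 : ‖(Φ (Ψ ⟨N, hm⟩) : EuclideanSpace ℝ (Fin n))‖ = 0 := by
      rw [hΦ, norm_coneHomeomorph, hΨN hm, norm_zero]
    rw [norm_eq_zero.1 h1, hΨ₀N hm₀]
  · -- `g w ↦ Ψ(g w) ↦ φ(Ψ(g w)) = Ψ₀(g₀ w) ↦ g₀ w`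
    rw [Homeomorph.trans_apply, Homeomorph.trans_apply, Homeomorph.symm_apply_eq]
    apply Subtype.ext
    have h1 : ‖(Ψ ⟨g w, hm⟩ : EuclideanSpace ℝ (Fin n))‖ = 1 := (hb _).2 ⟨w, hw, rfl⟩
    rw [hΦ, coneHomeomorph_apply_of_norm_eq_one φ _ h1]
    have h2 : (⟨(Ψ ⟨g w, hm⟩ : EuclideanSpace ℝ (Fin n)), mem_sphere_zero_iff_norm.2 h1⟩ :
        sphere (0 : EuclideanSpace ℝ (Fin n)) 1) = β ⟨w, hw⟩ := Subtype.ext (hβ w hw hm).symm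
    rw [h2, hφ, Homeomorph.trans_apply, Homeomorph.symm_apply_apply, hβ₀ w hw hm₀]

/-! ### Step 4. Pasting: a homeomorphism of the sphere `S` extending `g₀ ∘ g⁻¹` on `g(B̄(0, r))` -/

/-- **Pasting the inner and outer pieces.** With `g, g₀ : X → S` open embeddings of a proper
normed space into a compact Hausdorff space missing `N`, and a homeomorphism
`Ω : S ∖ g(B(0, r)) ≅ S ∖ g₀(B(0, r))` of the outer pieces with `Ω N = N` and `Ω(g w) = g₀ w` for
`‖w‖ = r`, the map which is `g₀ ∘ g⁻¹` on `g(B̄(0, r))` and `Ω` outside `g(B(0, r))` is a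
well-defined continuous bijection of `S` (pasting along a closed cover), hence a homeomorphism `F`
with `F N = N` and `F (g w) = g₀ w` for `‖w‖ ≤ r`. [folklore] -/
theorem exists_homeomorph_sphere_extend {X S : Type*} [NormedAddCommGroup X] [ProperSpace X]
    [TopologicalSpace S] [CompactSpace S] [T2Space S] {g g₀ : X → S} (hg : IsOpenEmbedding g)
    (hg₀ : IsOpenEmbedding g₀) {N : S} (hN : N ∉ range g) (hN₀ : N ∉ range g₀) {r : ℝ}
    (Ω : ↥(g '' ball (0 : X) r)ᶜ ≃ₜ ↥(g₀ '' ball (0 : X) r)ᶜ)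
    (hΩN : ∀ hm hm₀, Ω ⟨N, hm⟩ = ⟨N, hm₀⟩)
    (hΩg : ∀ w ∈ sphere (0 : X) r, ∀ hm hm₀, Ω ⟨g w, hm⟩ = ⟨g₀ w, hm₀⟩) :
    ∃ F : S ≃ₜ S, F N = N ∧ ∀ w ∈ closedBall (0 : X) r, F (g w) = g₀ w := by
  classical
  haveI : Nonempty X := ⟨0⟩
  -- the two closed pieces `A = g(B̄(0, r))`, `C = S ∖ g(B(0, r))`
  have hAc : IsClosed (g '' closedBall (0 : X) r) :=
    ((isCompact_closedBall _ _).image hg.continuous).isClosed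
  have hCc : IsClosed (g '' ball (0 : X) r)ᶜ := (hg.isOpenMap _ isOpen_ball).isClosed_compl
  have hAC : g '' closedBall (0 : X) r ∪ (g '' ball (0 : X) r)ᶜ = univ := by
    refine eq_univ_of_forall fun z ↦ ?_
    by_cases hz : z ∈ g '' closedBall (0 : X) r
    · exact Or.inl hz
    · exact Or.inr fun hz' ↦ hz (image_mono ball_subset_closedBall hz')
  have hnotC : ∀ {z}, z ∉ (g '' ball (0 : X) r)ᶜ → ∃ w ∈ ball (0 : X) r, g w = z := fun hz ↦ by
    simpa using hz
  -- the map
  set F : S → S := fun z ↦ if z ∈ g '' closedBall (0 : X) r then g₀ (invFun g z)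
    else if hz : z ∈ (g '' ball (0 : X) r)ᶜ then (Ω ⟨z, hz⟩ : S) else z with hF
  have hginv : ∀ w, invFun g (g w) = w := leftInverse_invFun hg.injective
  have hFin : ∀ w ∈ closedBall (0 : X) r, F (g w) = g₀ w := by
    intro w hw
    have : g w ∈ g '' closedBall (0 : X) r := ⟨w, hw, rfl⟩
    simp only [hF, this, if_true, hginv]
  have hFout : ∀ z (hz : z ∈ (g '' ball (0 : X) r)ᶜ), F z = Ω ⟨z, hz⟩ := by
    intro z hz
    by_cases hzA : z ∈ g '' closedBall (0 : X) r
    · -- on the common boundary sphere the two prescriptions agree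
      obtain ⟨w, hw, rfl⟩ := hzA
      have hws : w ∈ sphere (0 : X) r := by
        refine mem_sphere_zero_iff_norm.2 (le_antisymm (mem_closedBall_zero_iff.1 hw) ?_)
        by_contra hlt
        exact hz ⟨w, mem_ball_zero_iff.2 (not_le.1 hlt), rfl⟩
      have hm₀ : g₀ w ∈ (g₀ '' ball (0 : X) r)ᶜ :=
        apply_mem_compl_image_ball hg₀.injective (mem_sphere_zero_iff_norm.1 hws).ge
      rw [hFin w hw, hΩg w hws hz hm₀]
    · simp only [hF, hzA, if_false, hz, dif_pos]
  -- continuity, by pasting along the closed cover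
  have hcontA : ContinuousOn F (g '' closedBall (0 : X) r) := by
    have hinv : ContinuousOn (invFun g) (range g) := by
      rw [continuousOn_iff_continuous_restrict]
      have heq : (range g).restrict (invFun g) = hg.toIsEmbedding.toHomeomorph.symm := by
        funext z
        obtain ⟨v, hv⟩ := z.2
        have hz : z = ⟨g v, v, rfl⟩ := Subtype.ext hv.symm
        rw [hz, Set.restrict_apply, hginv, IsEmbedding.toHomeomorph_symm_apply]
      rw [heq]
      exact hg.toIsEmbedding.toHomeomorph.symm.continuous
    have h1 : ContinuousOn (fun z ↦ g₀ (invFun g z)) (g '' closedBall (0 : X) r) :=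
      hg₀.continuous.comp_continuousOn (hinv.mono (image_subset_range _ _))
    exact h1.congr fun z hz ↦ by simp only [hF, hz, if_true]
  have hcontC : ContinuousOn F (g '' ball (0 : X) r)ᶜ := by
    rw [continuousOn_iff_continuous_restrict]
    have heq : (g '' ball (0 : X) r)ᶜ.restrict F = fun z ↦ (Ω z : S) :=
      funext fun z ↦ hFout z z.2
    rw [heq]
    exact continuous_subtype_val.comp Ω.continuous
  have hcont : Continuous F := by
    rw [← continuousOn_univ, ← hAC]
    exact hcontA.union_of_isClosed hcontC hAc hCc
  -- bijectivity
  have hinj : Injective F := by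
    intro z₁ z₂ h
    by_cases h₁ : z₁ ∈ (g '' ball (0 : X) r)ᶜ <;> by_cases h₂ : z₂ ∈ (g '' ball (0 : X) r)ᶜ
    · rw [hFout z₁ h₁, hFout z₂ h₂] at h
      exact congrArg Subtype.val (Ω.injective (Subtype.ext h))
    · obtain ⟨w₂, hw₂, rfl⟩ := hnotC h₂
      rw [hFout z₁ h₁, hFin w₂ (ball_subset_closedBall hw₂)] at h
      exact absurd ⟨w₂, hw₂, h.symm⟩ (Ω ⟨z₁, h₁⟩).2
    · obtain ⟨w₁, hw₁, rfl⟩ := hnotC h₁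
      rw [hFout z₂ h₂, hFin w₁ (ball_subset_closedBall hw₁)] at h
      exact absurd ⟨w₁, hw₁, h⟩ (Ω ⟨z₂, h₂⟩).2
    · obtain ⟨w₁, hw₁, rfl⟩ := hnotC h₁
      obtain ⟨w₂, hw₂, rfl⟩ := hnotC h₂
      rw [hFin w₁ (ball_subset_closedBall hw₁), hFin w₂ (ball_subset_closedBall hw₂)] at h
      rw [hg₀.injective h]
  have hsurj : Surjective F := by
    intro y
    by_cases hy : y ∈ (g₀ '' ball (0 : X) r)ᶜ
    · refine ⟨(Ω.symm ⟨y, hy⟩ : S), ?_⟩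
      rw [hFout _ (Ω.symm ⟨y, hy⟩).2, Subtype.coe_eta, Homeomorph.apply_symm_apply]
    · obtain ⟨w, hw, rfl⟩ : ∃ w ∈ ball (0 : X) r, g₀ w = y := by simpa using hy
      exact ⟨g w, hFin w (ball_subset_closedBall hw)⟩
  -- the homeomorphism
  have hNC : N ∈ (g '' ball (0 : X) r)ᶜ := fun ⟨v, _, hv⟩ ↦ hN ⟨v, hv⟩
  have hNC₀ : N ∈ (g₀ '' ball (0 : X) r)ᶜ := fun ⟨v, _, hv⟩ ↦ hN₀ ⟨v, hv⟩
  refine ⟨Continuous.homeoOfEquivCompactToT2 (f := Equiv.ofBijective F ⟨hinj, hsurj⟩) hcont, ?_,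
    fun w hw ↦ hFin w hw⟩
  show F N = N
  rw [hFout N hNC, hΩN hNC hNC₀]

/-! ### Step 5. Descending a homeomorphism of `S` fixing `N` to `S ∖ {N} ≅ ℝⁿ` -/

/-- **Conjugating down to the punctured sphere.** If `j : X → S` is an embedding with range
`S ∖ {N}` and `F : S ≅ S` fixes `N`, then `F` restricts, along `j`, to a homeomorphism `H` of `X`:
`j ∘ H = F ∘ j`. [folklore] -/
theorem exists_homeomorph_conj_of_apply_eq {X S : Type*} [TopologicalSpace X] [TopologicalSpace S]
    {j : X → S} (hj : IsEmbedding j) {N : S} (hrange : range j = {N}ᶜ) (F : S ≃ₜ S)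
    (hFN : F N = N) : ∃ H : X ≃ₜ X, ∀ x, j (H x) = F (j x) := by
  have himg : F '' range j = range j := by
    rw [hrange, Homeomorph.image_compl, image_singleton, hFN]
  have key : ∀ z : range j, j (hj.toHomeomorph.symm z) = z := fun z ↦ by
    have h := congrArg Subtype.val (hj.toHomeomorph.apply_symm_apply z)
    rwa [IsEmbedding.toHomeomorph_apply_coe] at h
  refine ⟨hj.toHomeomorph.trans ((F.image (range j)).trans
    ((Homeomorph.setCongr himg).trans hj.toHomeomorph.symm)), fun x ↦ ?_⟩
  rw [Homeomorph.trans_apply, Homeomorph.trans_apply, Homeomorph.trans_apply, key]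
  rfl

/-! ### Step 6. The theorem -/

/-- **A topological radial function, restricted to `[0, r]`, extends to a topological polar
coordinate on all of `ℝⁿ` (`n ≥ 2`).** Let `R ⊆ ℝⁿ` be open and `e : R ≅ ℝⁿ` a homeomorphism
(so that `ρ = ‖e ·‖` is a *topological radial function* on `R`: "a homeomorphism followed by the
usual radius function", DeMichelis–Freedman p. 246). Then for every `r > 0` there is a
homeomorphism `H : ℝⁿ ≅ ℝⁿ` of the whole space which agrees with `e` on the closed `ρ`-ball
`{x ∈ R | ρ(x) ≤ r}`; in particular `‖H ·‖` is a topological polar coordinate on all of `ℝⁿ`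
extending `ρ|_{ρ ≤ r}` (`norm_eq_norm_of_norm_le`). This is the last assertion of Thm. 4.1
("Also, `ρ` restricted to `[0, r]` for any `r` extends to a topological polar coordinate on all of
`ℝ⁴_std`", p. 246), whose printed proof is the one line "The final assertion of Theorem 4.1
follows from the Schoenflies theorem" (p. 248). Proof as printed, spelled out: in the one-point
compactification `S = ℝⁿ ∪ {∞} ≅ Sⁿ` the `ρ`-sphere `e⁻¹(∂B(0, r))` is bicollared, so by the
generalized Schoenflies theorem (Brown; the tree's
`IsTopSphere.nonempty_homeomorph_compl_image_ball`) the closure of its outer side is an `n`-cell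
with boundary the `ρ`-sphere, as is the outside of the round sphere `∂B(0, r)`; match the two
cells by a homeomorphism fixing `∞` and equal to `e` on the `ρ`-sphere (moving the centre,
Step 1, and coning the boundary correspondence, Alexander trick, Steps 2–3), paste with `e` on the
closed `ρ`-ball (Step 4), and remove `∞` (Step 5).
[cite: DeMichelisFreedman1992, Thm. 4.1 (final assertion), p. 246, and its proof, p. 248] -/
theorem exists_homeomorph_eq_of_norm_le (hn : 2 ≤ n) (R : TopologicalSpace.Opens (EuclideanSpace ℝ (Fin n)))
    (e : R ≃ₜ EuclideanSpace ℝ (Fin n)) {r : ℝ} (hr : 0 < r) :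
    ∃ H : EuclideanSpace ℝ (Fin n) ≃ₜ EuclideanSpace ℝ (Fin n),
      ∀ x : R, ‖e x‖ ≤ r → H x = e x := by
  -- the round sphere `S ≅ ℝⁿ ∪ {∞}` and the embedding `j` of `ℝⁿ`
  haveI : Fact (Module.finrank ℝ (EuclideanSpace ℝ (Fin (n + 1))) = n + 1) := ⟨by simp⟩
  have hS : IsTopSphere n (sphere (0 : EuclideanSpace ℝ (Fin (n + 1))) 1) := isTopSphere_sphere
  set Θ : OnePoint (EuclideanSpace ℝ (Fin n)) ≃ₜ sphere (0 : EuclideanSpace ℝ (Fin (n + 1))) 1 :=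
    onePointEquivSphereOfFinrankEq (by simp) with hΘ
  set j : EuclideanSpace ℝ (Fin n) → sphere (0 : EuclideanSpace ℝ (Fin (n + 1))) 1 :=
    fun v ↦ Θ (v : OnePoint (EuclideanSpace ℝ (Fin n))) with hj'
  have hj : IsOpenEmbedding j := Θ.isOpenEmbedding.comp OnePoint.isOpenEmbedding_coe
  have hrange : range j = {Θ OnePoint.infty}ᶜ := by
    rw [show j = Θ ∘ ((↑) : EuclideanSpace ℝ (Fin n) → OnePoint (EuclideanSpace ℝ (Fin n))) from rfl,
      range_comp, ← OnePoint.compl_infty, Homeomorph.image_compl, image_singleton]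
  have hN : Θ OnePoint.infty ∉ range j := by
    rw [hrange]
    exact fun h ↦ h rfl
  -- the open embedding `f = e⁻¹ : ℝⁿ → R ⊆ ℝⁿ` and `g = j ∘ f`
  set f : EuclideanSpace ℝ (Fin n) → EuclideanSpace ℝ (Fin n) := fun v ↦ (e.symm v : EuclideanSpace ℝ (Fin n))
    with hf'
  have hf : IsOpenEmbedding f := R.isOpen.isOpenEmbedding_subtypeVal.comp e.symm.isOpenEmbedding
  have hg : IsOpenEmbedding (j ∘ f) := hj.comp hf
  have hNg : Θ OnePoint.infty ∉ range (j ∘ f) := fun ⟨v, hv⟩ ↦ hN ⟨f v, hv⟩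
  -- Schoenflies twice, pasting, descent
  obtain ⟨Ω, hΩN, hΩg⟩ := exists_homeomorph_compl_image_ball hS hn hg hj hNg hN hr
  obtain ⟨F, hFN, hF⟩ := exists_homeomorph_sphere_extend hg hj hNg hN Ω hΩN hΩg
  obtain ⟨H, hH⟩ := exists_homeomorph_conj_of_apply_eq hj.toIsEmbedding hrange F hFN
  refine ⟨H, fun x hx ↦ hj.injective ?_⟩
  have hfx : (j ∘ f) (e x) = j x := by
    simp only [Function.comp_apply, hf', Homeomorph.symm_apply_apply]
  rw [hH, ← hfx, hF (e x) (mem_closedBall_zero_iff.2 hx)]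

/-- **The extended polar coordinate has radial function `ρ` on `ρ ≤ r`**: with `H` as in
`exists_homeomorph_eq_of_norm_le`, `‖H x‖ = ‖e x‖ = ρ(x)` whenever `ρ(x) ≤ r` — "`ρ` restricted to
`[0, r]` extends to a topological polar coordinate on all of `ℝⁿ`".
[cite: DeMichelisFreedman1992, Thm. 4.1 (final assertion), p. 246] -/
theorem exists_homeomorph_norm_eq_of_norm_le (hn : 2 ≤ n)
    (R : TopologicalSpace.Opens (EuclideanSpace ℝ (Fin n))) (e : R ≃ₜ EuclideanSpace ℝ (Fin n))
    {r : ℝ} (hr : 0 < r) :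
    ∃ H : EuclideanSpace ℝ (Fin n) ≃ₜ EuclideanSpace ℝ (Fin n),
      (∀ x : R, ‖e x‖ ≤ r → ‖H x‖ = ‖e x‖) ∧
      ∀ y : EuclideanSpace ℝ (Fin n), ‖H y‖ ≤ r ↔ ∃ hy : y ∈ R, ‖e ⟨y, hy⟩‖ ≤ r := by
  obtain ⟨H, hH⟩ := exists_homeomorph_eq_of_norm_le hn R e hr
  refine ⟨H, fun x hx ↦ by rw [hH x hx], fun y ↦ ⟨fun hy ↦ ?_, fun ⟨hy, hle⟩ ↦ ?_⟩⟩
  · -- `H y` lies in `B̄(0, r) = H(closed ρ-ball)`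
    set x : R := e.symm (H y) with hx
    have hex : e x = H y := by rw [hx, Homeomorph.apply_symm_apply]
    have hxr : ‖e x‖ ≤ r := by rw [hex]; exact hy
    have hHx : H x = H y := by rw [hH x hxr, hex]
    have hyx : y = x := (H.injective hHx).symm
    refine ⟨hyx ▸ x.2, ?_⟩
    have : (⟨y, hyx ▸ x.2⟩ : R) = x := Subtype.ext hyx
    rw [this]
    exact hxr
  · have h := hH ⟨y, hy⟩ hle
    rw [show (y : EuclideanSpace ℝ (Fin n)) = ((⟨y, hy⟩ : R) : EuclideanSpace ℝ (Fin n)) from rfl, h]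
    exact hle

/-- **The polar family of Thm. 4.1: the closed polar balls are standard in `ℝⁿ`.** For the
topological polar coordinates of `R ≅ ℝⁿ` (`n ≥ 2`) with radial function `ρ = ‖e ·‖` and a parameter
`t < 1` (radius `r = (1 − t)⁻¹`, `t = 1 − 1/r`; the open polar ball is the tree's `polarBall R e t`
of `ExoticOpenFourSpacePolarProofs`), some homeomorphism of `ℝⁿ` agrees with `e` on the closed polar
ball `{(1 − t) ρ ≤ 1}` — so it carries `polarBall R e t` onto the round open ball of radius
`(1 − t)⁻¹` and the closed polar ball onto the round closed ball.
[cite: DeMichelisFreedman1992, Thm. 4.1 (final assertion), p. 246] -/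
theorem exists_homeomorph_eq_of_polar (hn : 2 ≤ n)
    (R : TopologicalSpace.Opens (EuclideanSpace ℝ (Fin n))) (e : R ≃ₜ EuclideanSpace ℝ (Fin n))
    {t : ℝ} (ht : t < 1) :
    ∃ H : EuclideanSpace ℝ (Fin n) ≃ₜ EuclideanSpace ℝ (Fin n),
      (∀ x : R, (1 - t) * ‖e x‖ ≤ 1 → H x = e x) ∧
      H '' (polarBall R e t : Set (EuclideanSpace ℝ (Fin n))) = ball 0 (1 - t)⁻¹ := by
  have h1t : 0 < 1 - t := sub_pos.2 ht
  obtain ⟨H, hH⟩ := exists_homeomorph_eq_of_norm_le hn R e (inv_pos.2 h1t)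
  have hH' : ∀ x : R, (1 - t) * ‖e x‖ ≤ 1 → H x = e x := fun x hx ↦
    hH x (by rw [inv_eq_one_div, le_div_iff₀ h1t, mul_comm]; exact hx)
  refine ⟨H, hH', Subset.antisymm ?_ fun z hz ↦ ?_⟩
  · rintro _ ⟨y, hy, rfl⟩
    obtain ⟨hyR, hlt⟩ := (mem_polarBall R e).1 hy
    rw [mem_ball_zero_iff,
      show y = ((⟨y, hyR⟩ : R) : EuclideanSpace ℝ (Fin n)) from rfl, hH' _ hlt.le,
      inv_eq_one_div, lt_div_iff₀ h1t, mul_comm]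
    exact hlt
  · rw [mem_ball_zero_iff, inv_eq_one_div, lt_div_iff₀ h1t, mul_comm] at hz
    set x : R := e.symm z with hx
    have hex : e x = z := by rw [hx, Homeomorph.apply_symm_apply]
    have hxlt : (1 - t) * ‖e x‖ < 1 := by rwa [hex]
    refine ⟨x, (coe_mem_polarBall R e).2 hxlt, ?_⟩
    rw [hH' x hxlt.le, hex]

/-- **Thm. 4.1, final assertion, in dimension four** (the case of the theorem: `R⁴₁ ⊂ ℝ⁴_std` with
its topological system of polar coordinates): for an open `R ⊆ ℝ⁴` homeomorphic to `ℝ⁴` by `e` and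
any `r > 0`, the radial function `ρ = ‖e ·‖` restricted to `ρ ≤ r` extends to a topological polar
coordinate `‖H ·‖`, `H : ℝ⁴ ≅ ℝ⁴`, on all of `ℝ⁴_std`.
[cite: DeMichelisFreedman1992, Thm. 4.1 (final assertion), p. 246, and its proof, p. 248] -/
theorem exists_homeomorph_eq_of_norm_le_four
    (R : TopologicalSpace.Opens (EuclideanSpace ℝ (Fin 4))) (e : R ≃ₜ EuclideanSpace ℝ (Fin 4))
    {r : ℝ} (hr : 0 < r) :
    ∃ H : EuclideanSpace ℝ (Fin 4) ≃ₜ EuclideanSpace ℝ (Fin 4), ∀ x : R, ‖e x‖ ≤ r → H x = e x :=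
  exists_homeomorph_eq_of_norm_le (by norm_num) R e hr

end Literature.Barriers.SmoothPoincare4
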